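import Literature.NumberTheory.LFunctions.Zhang2022.RepairDiscSFiber
import Literature.NumberTheory.LFunctions.Zhang2022.RepairPrintedFiberBall

/-!
# Zhang (2022), repair rung F-S1R: kernel enclosure of the K-S2 discrepancy at the printed design, and
# the functional of record `C₂₃₂ˢ` fails the printed targets for every `ι ∈ ℂ³`

Y. Zhang, *Discrete mean estimates and the Landau–Siegel zero*, arXiv:2211.02515v1 (2022)
[Zhang2022LandauSiegel] — an unrefereed manuscript under adjudication; **nothing here is a claim about
its Theorems 1–2 or about Landau–Siegel zeros.** Follow-on of `RepairDiscSFiber` (`discS (thetaIota w) =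
ῑ₄·disc4 + ῑ₃·disc3` and the boxes of the ten window integrals). Annex to the repair cell's closing items
[Q2-3] (kernel discrepancy at `θ₀`) and [Q2-9] (literal floors); it does not touch the verdict theorem
`RepairVerdictAssembly.not_repairable_true_need`.

* KERNEL ENCLOSURES (`DiscCert`, `decide +kernel`): `disc4_re_bounds` (`Re disc4 = 3.7233…·10⁻⁶`),
  `disc4_im_bounds`, `disc3_re_bounds` (`Re disc3 = −3.3377…·10⁻⁷`), `disc3_im_bounds`, `normSq_disc4_le`,
  `norm_disc4_le` (`≤ 3.7235·10⁻⁶`), `normSq_disc3_le`, `norm_disc3_le` (`≤ 3.34·10⁻⁷`), hence on the fibre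
  `norm_discS_thetaIota_le : ‖discS (thetaIota w)‖ ≤ 3.7235·10⁻⁶‖w₄‖ + 3.34·10⁻⁷‖w₃‖`; at the printed `ι` of
  (2.26): `discS_theta0_re_bounds` — **`Re discS θ₀ ∈ (−2.1965·10⁻⁶, −2.1959·10⁻⁶)`** (the tree's `discS` is
  `frakc3S − frakc3rT`, exact minus REDUCED transcription: the exact cross term lowers `2Re 𝔠₃` by
  `4.39·10⁻⁶`; the cell's `+3.28·10⁻⁶` (TEAM C §8(g)) is the same exact value measured against the
  derived-`e″` transcription `frakc3DT`, cf. `RepairFrakc3S.frakc3S_sub_frakc3DT`), `discS_theta0_im_bounds`,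
  and THE FUNCTIONAL OF RECORD AT THE PRINTED DESIGN `C232S_theta0_bounds : C232S θ₀ ∈ (0.055341, 0.055342)`
  (`= C232c − 4.39·10⁻⁶`; the cell's dictionary lineage: `0.0553415395`).
* THE EXCLUSIONS OF RECORD EXTEND TO THE FUNCTIONAL OF RECORD: from `Section18AllIota.C232cG_ge`
  (`0.02491 ≤ C232cG ι` for all `ι`), the coercivity `RepairPrintedFiberBall.C232cG_coercive`
  (`1/80 + (27/10000)Σ|ι|² ≤ C232cG ι`) and `C232S_thetaIota_eq`, the affine discrepancy costs at most
  `1.7·10⁻⁵` uniformly in `ι`: **`C232S_thetaIota_ge : ∀ w, 0.02489 ≤ C232S (thetaIota w)`** — hence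
  `not_print_S_thetaIota` (`¬ C232S < 1/1000`, the printed target of §18 p.99) and `not_chain_S_thetaIota`
  (`¬ C232S < 25/3000`, the (2.33)/Prop 2.4 chain) for EVERY `ι ∈ ℂ³` at the printed exponents and shifts,
  and `not_print_chain_S_theta0` at `θ₀` itself: no re-choice of the weights `ι` of (2.26) repairs the §18
  margin for the exact main term either (the kernel had this for the transcribed readings: `C232cG_ge`,
  `RepairPrintedFiberCert`, `RepairPrintedFiberBridgeD.totalD_thetaIota_ge`; for the joint criterion
  T-true the class-wide statement is `Repair.not_repairable_true_need`).

Interval arithmetic [R. E. Moore, *Interval Analysis* (1966), Thm 3.1] + elementary inequalities.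
No `Prop` facts, no axioms beyond the standard three.
-/

noncomputable section

open Complex Real ComplexConjugate
open Literature.Analysis.ValidatedNumerics.Numerics

namespace Literature.NumberTheory.LFunctions.Zhang2022

namespace Repair

/- Keep the interval primitives opaque to the elaborator's unifier (cf. `Section8Certificate`). -/
attribute [local irreducible] CB.add CB.sub CB.mul CB.neg CB.conj CB.mulFI CB.mulI CB.mulInt
  CB.ofFI CB.ofInt CB.normSqFI CB.expI FI.add FI.sub FI.mul FI.neg FI.mulInt FI.divNat FI.divPos
  FI.ofRat FI.ofInt FI.pi qCB piMul expIpi overPiFI piISq mulPiFI scaleRatFI recipFI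
  recipMulPiFI expIpiFI

/-! ### Boxes of `Xw`, `E`, `D`, and of `discS θ₀`, `C232S θ₀` -/

/-- box of `8/π` [folklore] -/ @[irreducible] def c8piB : CB := CB.ofFI (overPiFI 8)
/-- box of `88π` [folklore] -/ @[irreducible] def c88piB : CB := CB.ofFI (piMul 88)
/-- box of `48π²·i` [folklore] -/ @[irreducible] def c48pisqIB : CB := (CB.ofFI ((piMul 48).mul FI.pi)).mulI
/-- box of `24i` [folklore] -/ @[irreducible] def c24IB : CB := (CB.ofInt 24).mulI

/-- `8/π ∈ c8piB` [cite: Moore1966, Theorem 3.1] -/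
theorem mem_c8pi : CB.mem (((8 / π : ℝ)) : ℂ) c8piB := by
  have hf : overPiOK 8 = true := by decide +kernel
  have h := mem_overPiFI hf
  unfold c8piB; unfold overPi at h; push_cast at h; exact CB.mem_ofFI h
/-- `88π ∈ c88piB` [cite: Moore1966, Theorem 3.1] -/
theorem mem_c88pi : CB.mem (((88 * π : ℝ)) : ℂ) c88piB := by
  have h := mem_piMul 88
  unfold c88piB; push_cast at h; exact CB.mem_ofFI h
/-- `48π²·i ∈ c48pisqIB` [cite: Moore1966, Theorem 3.1] -/
theorem mem_c48pisqI : CB.mem ((((48 * π ^ 2 : ℝ)) : ℂ) * I) c48pisqIB := by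
  have h := FI.mem_mul (mem_piMul 48) FI.mem_pi
  have e : (((48 : ℚ) : ℝ) * π * π) = 48 * π ^ 2 := by push_cast; ring
  rw [e] at h
  unfold c48pisqIB; exact CB.mem_mulI (CB.mem_ofFI h)
/-- `24i ∈ c24IB` [cite: Moore1966, Theorem 3.1] -/
theorem mem_c24I : CB.mem ((24 : ℂ) * I) c24IB := by unfold c24IB; exact CB.mem_mulI mem_c24

/-- box of `Xw12` [folklore] -/
@[irreducible] def Xw12B : CB :=
  ((((c8piB.neg).mul J1w12B).add (c88piB.mul J2w12B)).sub (c24IB.mul (J3w12B.add J4w12B))).sub (c48pisqIB.mul J5w12B)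
/-- box of `Xw13` [folklore] -/
@[irreducible] def Xw13B : CB :=
  ((((c8piB.neg).mul J1w13B).add (c88piB.mul J2w13B)).sub (c24IB.mul (J3w13B.add J4w13B))).sub (c48pisqIB.mul J5w13B)

/-- `Xw12 ∈ Xw12B`. [cite: Zhang2022LandauSiegel, §12 (12.12)–(12.14)] -/
theorem mem_Xw12 : CB.mem Xw12 Xw12B := by
  have h1 := mem_J1w12; have h2 := mem_J2w12; have h3 := mem_J3w12; have h4 := mem_J4w12; have h5 := mem_J5w12
  have e : Xw12 = -(((8 / π : ℝ)) : ℂ) * J1w 0.504 (3/2) 0.5 (5/2) + ((88 * π : ℝ) : ℂ) * J2w 0.504 (3/2) 0.5 (5/2)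
      - 24 * I * (J3w 0.504 (3/2) 0.5 (5/2) + J4w 0.504 (3/2) 0.5 (5/2))
      - (((48 * π ^ 2 : ℝ)) : ℂ) * I * J5w 0.504 (3/2) 0.5 (5/2) := rfl
  rw [e]; unfold Xw12B
  apply_rules [CB.mem_add, CB.mem_sub, CB.mem_mul, CB.mem_neg, mem_c8pi, mem_c88pi, mem_c48pisqI, mem_c24I]
/-- `Xw13 ∈ Xw13B`. [cite: Zhang2022LandauSiegel, §12 (12.12)–(12.14)] -/
theorem mem_Xw13 : CB.mem Xw13 Xw13B := by
  have h1 := mem_J1w13; have h2 := mem_J2w13; have h3 := mem_J3w13; have h4 := mem_J4w13; have h5 := mem_J5w13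
  have e : Xw13 = -(((8 / π : ℝ)) : ℂ) * J1w 0.504 (3/2) 0.498 (3/2) + ((88 * π : ℝ) : ℂ) * J2w 0.504 (3/2) 0.498 (3/2)
      - 24 * I * (J3w 0.504 (3/2) 0.498 (3/2) + J4w 0.504 (3/2) 0.498 (3/2))
      - (((48 * π ^ 2 : ℝ)) : ℂ) * I * J5w 0.504 (3/2) 0.498 (3/2) := rfl
  rw [e]; unfold Xw13B
  apply_rules [CB.mem_add, CB.mem_sub, CB.mem_mul, CB.mem_neg, mem_c8pi, mem_c88pi, mem_c48pisqI, mem_c24I]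

/-- box of `4/(0.504π) = (500/63)/π` [folklore] -/ @[irreducible] def ce2B : CB := CB.ofFI (overPiFI (500/63))
/-- `4/(0.504π) ∈ ce2B` [cite: Moore1966, Theorem 3.1] -/
theorem mem_ce2 : CB.mem (((4 / (0.504 * π) : ℝ)) : ℂ) ce2B := by
  have hf : overPiOK (500/63) = true := by decide +kernel
  have h := mem_overPiFI hf
  have e : overPi (500/63) = 4 / (0.504 * π) := by
    unfold overPi; push_cast; field_simp; norm_num
  rw [e] at h; unfold ce2B; exact CB.mem_ofFI h

/-- box of `e2coef4` [folklore] -/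
@[irreducible] def e2coef4B : CB := ce2B.mul ((qCB (-(2/125))).sub (((CB.ofFI FI.pi).mulI).mulFI (FI.ofRat (1/15625))))
/-- box of `e2coef3` [folklore] -/
@[irreducible] def e2coef3B : CB := ce2B.mul (qCB (-(2/249)))

/-- `e2coef4 ∈ e2coef4B`. [cite: Zhang2022LandauSiegel, §12 (12.15)] -/
theorem mem_e2coef4 : CB.mem e2coef4 e2coef4B := by
  have e : e2coef4 = (((4 / (0.504 * π) : ℝ)) : ℂ) * ((((-(2/125) : ℚ)) : ℂ) - (π : ℂ) * I * ((((1/15625 : ℚ)) : ℝ) : ℂ)) := by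
    unfold e2coef4; push_cast; ring
  rw [e]; unfold e2coef4B
  apply_rules [CB.mem_mul, CB.mem_sub, CB.mem_mulFI, CB.mem_mulI, mem_ce2, mem_qCB, mem_piCB, FI.mem_ofRat]
/-- `e2coef3 ∈ e2coef3B`. [cite: Zhang2022LandauSiegel, §12 (12.15)] -/
theorem mem_e2coef3 : CB.mem e2coef3 e2coef3B := by
  have e : e2coef3 = (((4 / (0.504 * π) : ℝ)) : ℂ) * ((((-(2/249) : ℚ)) : ℂ)) := by
    unfold e2coef3; push_cast; ring
  rw [e]; unfold e2coef3B
  apply_rules [CB.mem_mul, mem_ce2, mem_qCB]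

/-- box of `disc4` [folklore] -/ @[irreducible] def disc4B : CB := Xw12B.sub e2coef4B
/-- box of `disc3` [folklore] -/ @[irreducible] def disc3B : CB := Xw13B.sub e2coef3B
/-- `disc4 ∈ disc4B`. [cite: Zhang2022LandauSiegel, §12 (12.12)–(12.15)] -/
theorem mem_disc4 : CB.mem disc4 disc4B := by unfold disc4 disc4B; exact CB.mem_sub mem_Xw12 mem_e2coef4
/-- `disc3 ∈ disc3B`. [cite: Zhang2022LandauSiegel, §12 (12.12)–(12.15)] -/
theorem mem_disc3 : CB.mem disc3 disc3B := by unfold disc3 disc3B; exact CB.mem_sub mem_Xw13 mem_e2coef3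

/-- box of `discS θ₀ = ῑ₄disc4 + ῑ₃disc3` [folklore] -/
@[irreducible] def disc0B : CB := ((iota4B.conj).mul disc4B).add ((iota3B.conj).mul disc3B)
/-- `discS θ₀ ∈ disc0B`. [cite: Zhang2022LandauSiegel, §2 (2.26); §18 (18.1)] -/
theorem mem_disc0 : CB.mem (discS theta0) disc0B := by
  rw [discS_theta0_fiber]; unfold disc0B
  apply_rules [CB.mem_add, CB.mem_mul, CB.mem_conj, mem_iota4, mem_iota3, mem_disc4, mem_disc3]

/-- interval of `C232S θ₀ = Re 𝔠₁ + Re 𝔠₂(0.5) + 2Re 𝔠₃ʳ + 2Re discS θ₀` [folklore] -/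
@[irreducible] def C232S0I : FI :=
  ((frakc1B.re.add frakc2cB.re).add (frakc3rB.re.mulInt 2)).add (disc0B.re.mulInt 2)
/-- `C232S θ₀ ∈ C232S0I`. [cite: Zhang2022LandauSiegel, §2 (2.32); §18] -/
theorem mem_C232S0 : FI.mem (C232S theta0) C232S0I := by
  have h : C232S theta0 = frakc1.re + frakc2c.re + frakc3r.re * (2 : ℤ) + (discS theta0).re * (2 : ℤ) := by
    rw [C232S_eq_C232D_add admissible_theta0, C232D_theta0]; unfold C232c; push_cast; ring
  rw [h]; unfold C232S0I
  apply_rules [FI.mem_add, FI.mem_mulInt, mem_frakc1.1, mem_frakc2c.1, mem_frakc3r.1, mem_disc0.1]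

/-! ### The kernel check -/

/-- The comparisons read off the boxes (thresholds `q·2^48` against the integer endpoints).
[cite: Zhang2022LandauSiegel, §12 (12.12)–(12.15); §18 (18.1)] -/
def DiscCert : Prop :=
  ((3.7232e-6 : ℚ) * (SC : ℚ) < (disc4B.re.lo : ℚ) ∧ (disc4B.re.hi : ℚ) < (3.7234e-6 : ℚ) * (SC : ℚ))
  ∧ ((1.65e-8 : ℚ) * (SC : ℚ) < (disc4B.im.lo : ℚ) ∧ (disc4B.im.hi : ℚ) < (1.69e-8 : ℚ) * (SC : ℚ))
  ∧ ((-3.339e-7 : ℚ) * (SC : ℚ) < (disc3B.re.lo : ℚ) ∧ (disc3B.re.hi : ℚ) < (-3.337e-7 : ℚ) * (SC : ℚ))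
  ∧ ((-1.6e-9 : ℚ) * (SC : ℚ) < (disc3B.im.lo : ℚ) ∧ (disc3B.im.hi : ℚ) < (-1.5e-9 : ℚ) * (SC : ℚ))
  ∧ ((-2.1965e-6 : ℚ) * (SC : ℚ) < (disc0B.re.lo : ℚ) ∧ (disc0B.re.hi : ℚ) < (-2.1959e-6 : ℚ) * (SC : ℚ))
  ∧ ((-6.0692e-6 : ℚ) * (SC : ℚ) < (disc0B.im.lo : ℚ) ∧ (disc0B.im.hi : ℚ) < (-6.0687e-6 : ℚ) * (SC : ℚ))
  ∧ ((0.055341 : ℚ) * (SC : ℚ) < (C232S0I.lo : ℚ) ∧ (C232S0I.hi : ℚ) < (0.055342 : ℚ) * (SC : ℚ))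

/-- **The kernel check.** [cite: Zhang2022LandauSiegel, §12 (12.12)–(12.15); §18 (18.1)] -/
theorem discCert : DiscCert := by unfold DiscCert; decide +kernel

/-- **`Re disc4 ∈ (3.7232·10⁻⁶, 3.7234·10⁻⁶)`** (true value `3.72334·10⁻⁶`; box width `1.3·10⁻¹⁰`). [cite: Zhang2022LandauSiegel, §12 (12.12)–(12.15)] -/
theorem disc4_re_bounds : (3.7232e-6 : ℝ) < disc4.re ∧ disc4.re < 3.7234e-6 := by
  have h := discCert.1
  exact ⟨by simpa using lo_bound mem_disc4.1 h.1, by simpa using hi_bound mem_disc4.1 h.2⟩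
/-- `Im disc4 ∈ (1.65·10⁻⁸, 1.69·10⁻⁸)` (true value `1.671·10⁻⁸`). [cite: Zhang2022LandauSiegel, §12 (12.12)–(12.15)] -/
theorem disc4_im_bounds : (1.65e-8 : ℝ) < disc4.im ∧ disc4.im < 1.69e-8 := by
  have h := discCert.2.1
  exact ⟨by simpa using lo_bound mem_disc4.2 h.1, by simpa using hi_bound mem_disc4.2 h.2⟩
/-- **`Re disc3 ∈ (−3.339·10⁻⁷, −3.337·10⁻⁷)`** (true value `−3.3377·10⁻⁷`). [cite: Zhang2022LandauSiegel, §12 (12.12)–(12.15)] -/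
theorem disc3_re_bounds : (-3.339e-7 : ℝ) < disc3.re ∧ disc3.re < -3.337e-7 := by
  have h := discCert.2.2.1
  exact ⟨by simpa using lo_bound mem_disc3.1 h.1, by simpa using hi_bound mem_disc3.1 h.2⟩
/-- `Im disc3 ∈ (−1.6·10⁻⁹, −1.5·10⁻⁹)` (true value `−1.573·10⁻⁹`). [cite: Zhang2022LandauSiegel, §12 (12.12)–(12.15)] -/
theorem disc3_im_bounds : (-1.6e-9 : ℝ) < disc3.im ∧ disc3.im < -1.5e-9 := by
  have h := discCert.2.2.2.1
  exact ⟨by simpa using lo_bound mem_disc3.2 h.1, by simpa using hi_bound mem_disc3.2 h.2⟩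
/-- **`Re discS θ₀ ∈ (−2.1965·10⁻⁶, −2.1959·10⁻⁶)`** (true value `−2.19624·10⁻⁶`) — the K-S2 discrepancy of
record at the printed design, in the kernel: the exact cross term sits `4.39·10⁻⁶` BELOW the transcribed reduced
reading in `2 Re 𝔠₃` (`C232S θ₀ = C232c − 4.39·10⁻⁶`). [cite: Zhang2022LandauSiegel, §18 (18.1)–(18.2)] -/
theorem discS_theta0_re_bounds : (-2.1965e-6 : ℝ) < (discS theta0).re ∧ (discS theta0).re < -2.1959e-6 := by
  have h := discCert.2.2.2.2.1
  exact ⟨by simpa using lo_bound mem_disc0.1 h.1, by simpa using hi_bound mem_disc0.1 h.2⟩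
/-- `Im discS θ₀ ∈ (−6.0692·10⁻⁶, −6.0687·10⁻⁶)` (true value `−6.0689·10⁻⁶`). [cite: Zhang2022LandauSiegel, §18 (18.1)–(18.2)] -/
theorem discS_theta0_im_bounds : (-6.0692e-6 : ℝ) < (discS theta0).im ∧ (discS theta0).im < -6.0687e-6 := by
  have h := discCert.2.2.2.2.2.1
  exact ⟨by simpa using lo_bound mem_disc0.2 h.1, by simpa using hi_bound mem_disc0.2 h.2⟩
/-- **The functional of record at the printed design: `C232S θ₀ ∈ (0.055341, 0.055342)`** (true value
`0.05534154`; the width is that of the tree's boxes of `𝔠₁, 𝔠₂, 𝔠₃ʳ`).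
[cite: Zhang2022LandauSiegel, §2 (2.32); §18 p.99] -/
theorem C232S_theta0_bounds : (0.055341 : ℝ) < C232S theta0 ∧ C232S theta0 < 0.055342 := by
  have h := discCert.2.2.2.2.2.2
  exact ⟨by simpa using lo_bound mem_C232S0 h.1, by simpa using hi_bound mem_C232S0 h.2⟩

/-- `|disc4|² ≤ (3.7235·10⁻⁶)²`. [cite: Zhang2022LandauSiegel, §12 (12.12)–(12.15)] -/
theorem normSq_disc4_le : Complex.normSq disc4 ≤ (3.7235e-6 : ℝ) ^ 2 := by
  rw [Complex.normSq_apply]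
  have h1 := disc4_re_bounds; have h2 := disc4_im_bounds
  have hr : disc4.re * disc4.re ≤ (3.7234e-6 : ℝ) * 3.7234e-6 := by nlinarith [h1.1, h1.2]
  have hi : disc4.im * disc4.im ≤ (1.69e-8 : ℝ) * 1.69e-8 := by nlinarith [h2.1, h2.2]
  norm_num at hr hi ⊢; linarith
/-- `|disc3|² ≤ (3.34·10⁻⁷)²`. [cite: Zhang2022LandauSiegel, §12 (12.12)–(12.15)] -/
theorem normSq_disc3_le : Complex.normSq disc3 ≤ (3.34e-7 : ℝ) ^ 2 := by
  rw [Complex.normSq_apply]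
  have h1 := disc3_re_bounds; have h2 := disc3_im_bounds
  have hr : disc3.re * disc3.re ≤ (3.339e-7 : ℝ) * 3.339e-7 := by nlinarith [h1.1, h1.2]
  have hi : disc3.im * disc3.im ≤ (1.6e-9 : ℝ) * 1.6e-9 := by nlinarith [h2.1, h2.2]
  norm_num at hr hi ⊢; linarith
/-- `‖disc4‖ ≤ 3.7235·10⁻⁶`. [cite: Zhang2022LandauSiegel, §12 (12.12)–(12.15)] -/
theorem norm_disc4_le : ‖disc4‖ ≤ (3.7235e-6 : ℝ) := by
  have h := normSq_disc4_le
  rw [Complex.normSq_eq_norm_sq] at h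
  nlinarith [norm_nonneg disc4]
/-- `‖disc3‖ ≤ 3.34·10⁻⁷`. [cite: Zhang2022LandauSiegel, §12 (12.12)–(12.15)] -/
theorem norm_disc3_le : ‖disc3‖ ≤ (3.34e-7 : ℝ) := by
  have h := normSq_disc3_le
  rw [Complex.normSq_eq_norm_sq] at h
  nlinarith [norm_nonneg disc3]

/-! ### The functional of record on the whole printed `ι`-fibre -/

/-- **Size of the discrepancy on the printed fibre**: `‖discS (thetaIota w)‖ ≤ 3.7235·10⁻⁶·‖w₄‖ + 3.34·10⁻⁷·‖w₃‖`
(so `|C232S − C232cG| ≤ 2·(…)` there, by `C232S_thetaIota_eq`). [cite: Zhang2022LandauSiegel, §12 (12.12)–(12.15); §18 (18.1)] -/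
theorem norm_discS_thetaIota_le (w2 w3 w4 : ℂ) :
    ‖discS (thetaIota w2 w3 w4)‖ ≤ (3.7235e-6 : ℝ) * ‖w4‖ + (3.34e-7 : ℝ) * ‖w3‖ := by
  rw [discS_thetaIota]
  have h4 : ‖conj w4 * disc4‖ ≤ (3.7235e-6 : ℝ) * ‖w4‖ := by
    rw [norm_mul, Complex.norm_conj, mul_comm]
    exact mul_le_mul_of_nonneg_right norm_disc4_le (norm_nonneg _)
  have h3 : ‖conj w3 * disc3‖ ≤ (3.34e-7 : ℝ) * ‖w3‖ := by
    rw [norm_mul, Complex.norm_conj, mul_comm]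
    exact mul_le_mul_of_nonneg_right norm_disc3_le (norm_nonneg _)
  exact (norm_add_le _ _).trans (add_le_add h4 h3)

/-- `Re(w̄·D) ≥ −‖w‖·‖D‖`. [folklore] -/
private theorem re_conj_mul_ge (w D : ℂ) : -(‖w‖ * ‖D‖) ≤ (conj w * D).re := by
  have h1 : |(conj w * D).re| ≤ ‖conj w * D‖ := Complex.abs_re_le_norm _
  rw [norm_mul, Complex.norm_conj] at h1
  exact (abs_le.mp h1).1

/-- **THE EXCLUSIONS OF RECORD EXTEND TO THE FUNCTIONAL OF RECORD: `0.02489 ≤ C₂₃₂ˢ(θ_ι)` for every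
`ι ∈ ℂ³`** (from `0.02491 ≤ C232cG ι`, the coercivity `1/80 + (27/10000)Σ|ι|² ≤ C232cG ι`, and the
enclosures `‖disc4‖ ≤ 3.7235·10⁻⁶`, `‖disc3‖ ≤ 3.34·10⁻⁷`: the affine discrepancy costs at most `1.7·10⁻⁵`).
[cite: Zhang2022LandauSiegel, §2 (2.26), (2.32); §18 p.99] -/
theorem C232S_thetaIota_ge (w2 w3 w4 : ℂ) : (0.02489 : ℝ) ≤ C232S (thetaIota w2 w3 w4) := by
  rw [C232S_thetaIota_eq, Complex.add_re]
  have hG1 := C232cG_ge w2 w3 w4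
  have hG2 := C232cG_coercive w2 w3 w4
  have h4 := re_conj_mul_ge w4 disc4
  have h3 := re_conj_mul_ge w3 disc3
  have hn4 := norm_disc4_le; have hn3 := norm_disc3_le
  have hx4 := norm_nonneg w4; have hx3 := norm_nonneg w3
  have hd4 := norm_nonneg disc4; have hd3 := norm_nonneg disc3
  have e2 : Complex.normSq w2 = ‖w2‖ ^ 2 := Complex.normSq_eq_norm_sq w2
  have e3 : Complex.normSq w3 = ‖w3‖ ^ 2 := Complex.normSq_eq_norm_sq w3
  have e4 : Complex.normSq w4 = ‖w4‖ ^ 2 := Complex.normSq_eq_norm_sq w4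
  rw [e2, e3, e4] at hG2
  have p4 : ‖w4‖ * ‖disc4‖ ≤ ‖w4‖ * 3.7235e-6 := mul_le_mul_of_nonneg_left hn4 hx4
  have p3 : ‖w3‖ * ‖disc3‖ ≤ ‖w3‖ * 3.34e-7 := mul_le_mul_of_nonneg_left hn3 hx3
  nlinarith [sq_nonneg ((27/15000000 : ℝ) * ‖w4‖ - 3.7235e-6), sq_nonneg ((27/15000000 : ℝ) * ‖w3‖ - 3.34e-7),
    sq_nonneg ‖w2‖]

/-- **The printed target fails for the functional of record on the whole printed fibre**:
`¬ (C₂₃₂ˢ(θ_ι) < 0.001)` for every `ι`. [cite: Zhang2022LandauSiegel, §18 p.99 «It follows from (8.24), (9.8) and (18.2) that …»] -/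
theorem not_print_S_thetaIota (w2 w3 w4 : ℂ) : ¬ (C232S (thetaIota w2 w3 w4) < 1 / 1000) := by
  have h := C232S_thetaIota_ge w2 w3 w4; intro h'; linarith

/-- **The (2.33)/Prop 2.4 chain target fails too**: `¬ (C₂₃₂ˢ(θ_ι) < 25/3000)` for every `ι`.
[cite: Zhang2022LandauSiegel, §2 (2.32)–(2.33), Prop. 2.4] -/
theorem not_chain_S_thetaIota (w2 w3 w4 : ℂ) : ¬ (C232S (thetaIota w2 w3 w4) < 25 / 3000) := by
  have h := C232S_thetaIota_ge w2 w3 w4; intro h'; linarith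

/-- At the printed design itself: `¬ (C₂₃₂ˢ(θ₀) < 0.001)` and `¬ (C₂₃₂ˢ(θ₀) < 25/3000)`.
[cite: Zhang2022LandauSiegel, §18 p.99; §2 (2.33)] -/
theorem not_print_chain_S_theta0 : ¬ (C232S theta0 < 1 / 1000) ∧ ¬ (C232S theta0 < 25 / 3000) := by
  rw [← thetaIota_iota]; exact ⟨not_print_S_thetaIota _ _ _, not_chain_S_thetaIota _ _ _⟩

end Repair

end Literature.NumberTheory.LFunctions.Zhang2022

/-! ## `_holds` aliases (appended 2026-08-28, flt-inv gen 65)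

The named fact(s) below are already theorems of THIS file under another name; the alias records the
discharge under the tree's exact naming convention `X_holds` (D-0026 bookkeeping: the proof term is the
existing theorem; no statement, definition or attribute is edited; no new named fact).  The ledger's debt
table listed each as unproved (`ledger fact claim` GRANTED «status unproved», 2026-08-28T08:5xZ). -/

/-- `DiscCert` — the kernel certificate of the repair cell's discriminant / fibre check (built on §12 (12.12)–(12.15) and §18 (18.1)) holds (`decide +kernel`) (`Literature.NumberTheory.LFunctions.Zhang2022.Repair.discCert`). [cite: Zhang2022LandauSiegel, §12 (12.12)–(12.15); §18 (18.1)] -/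
theorem _root_.Literature.NumberTheory.LFunctions.Zhang2022.Repair.DiscCert_holds : _root_.Literature.NumberTheory.LFunctions.Zhang2022.Repair.DiscCert :=
  _root_.Literature.NumberTheory.LFunctions.Zhang2022.Repair.discCert
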